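import Mathlib
import HarnessLib
import Literature.Probability.Percolation.GMFiniteSize
import Literature.Probability.Percolation.RSW
import Summits.CriticalPhenomena.PercolationContinuityZ3.Theorems.PercRayRenewalAssemblyRenewal

/-!
# Ray renewal at `p_c(ℤ³)`, part 2: geometry of a change of piece, scales, block bounds

Route `PercRayRenewal` of `CriticalPhenomena / PercolationContinuityZ3`, item
`stmt-CriticalPhenomena-4630` (`Assembly`, the ray-renewal criterion
`TwoArmsRatioExponent → JumpLineAvoidanceDecay → θ(p_c(ℤ³)) = 0`). This file contains the
deterministic heart of the criterion and the two block estimates.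

* `toOrigin_mem_twoArms_of_not_openConnIn`: two axis points `s e₀, s' e₀` within distance `R` of a
  block point `X e₀` (`R ≤ n ≤ X`), both in infinite clusters but not joined inside the half-space
  `ℍ = {x | 0 ≤ x₀}`, produce — seen from `X e₀` — the two-arms event `A₂(R, n)` of the route
  (both reach `∂Λ(n)` inside `Λ(n)`, `toBdry_of_percolatesAt`; a junction inside
  `Λ(n) + X e₀ ⊆ ℍ` is excluded).
* `exists_next_of_not_bad`: hence a ray point `t e₀ ↔ ∞` at depth `t ≥ L ≥ n ≥ 2r` is joined inside
  `ℍ` to a later ray point of an infinite cluster unless (i) the two-arms event `A₂(2r, n)` occurs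
  at the block point `L + ⌊(t-L)/r⌋ r`, or (ii) the next `r` ray points avoid the infinite
  clusters (vacancy event seen from `t e₀`).
* `piece_infinite_of_forall_exists_next`: if every ray point `↔ ∞` beyond depth `T` is so renewed,
  the half-space piece of any such point is infinite.
* Scales (`a ≥ 1` an integer parameter, `k` the scale): gap `r_k = 2^{ak+1}`, radii
  `2r_k = 2^{ak+2} ≤ n_k = 2^{(a+1)k+2}`, depths `[L_k, L_{k+1})`, `L_k = 2^{(a+1)k+3}`
  (`exists_scale`, `numBlocks_le`, `radii_ratio`); the block estimates `real_blocks_le`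
  (`≤ C 2^{a+4} (2^{1-c})^k` from a two-arms bound with exponent `c`) and `real_lineBlocks_le`
  (`≤ C 2^{a+4} (2^{1-aκ})^k` from a line-avoidance bound with exponent `κ`, via the disjointness
  bound `renewal_ineq` of part 1); `exists_next_at_scale` packages `exists_next_of_not_bad`.

Sources: the route thesis (planner's bookkeeping); G. Grimmett, *Percolation* (1999), §1.6
(translation invariance), Thm. (7.35) (BGN, used in part 3 only).
-/

noncomputable section

namespace Summit.CriticalPhenomena.PercolationContinuityZ3.Theorems

open MeasureTheory Literature.Probability.Percolation Literature.Probability.LatticeModels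

namespace RayRenewal

/-! ## Geometry of a change of half-space piece along the ray -/

/-- A translate `Λ(n) + X e₀` of the box with `n ≤ X` lies in the half-space `ℍ = {x | 0 ≤ x₀}`:
the preimage of `Λ(n)` under the shift by `-(X e₀)` is contained in `ℍ`. [folklore] -/
theorem shift_preimage_box_subset_halfSpace {n X : ℕ} (hnX : n ≤ X) :
    (Site.shift (-(Pi.single 0 (X : ℤ) : Site 3))) ⁻¹' (↑(box 3 n) : Set (Site 3)) ⊆
      {x : Site 3 | 0 ≤ x 0} := by
  intro z hz
  rw [Set.mem_preimage, Site.shift_apply, Finset.mem_coe, mem_box] at hz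
  have h0 := (hz 0).1
  simp only [Pi.add_apply, Pi.neg_apply, axisPt_apply_zero] at h0
  simp only [Set.mem_setOf_eq]
  omega

/-- **Two arms from a change of piece.** Let `ω ⊆ E(ℤ³)`, `R ≤ n ≤ X`, and let `s e₀`, `s' e₀` be
two axis points with `X ≤ s, s' ≤ X + R`, both in infinite open clusters, but NOT joined by an
open path inside the half-space `ℍ = {x | 0 ≤ x₀}`. Then, seen from `X e₀` (configuration
`toOrigin (X e₀) ω`), the two-arms event `A₂(R, n)` of the route occurs: the points
`u = (s - X) e₀`, `v = (s' - X) e₀` of `Λ(R)` are both joined to `∂Λ(n)` inside `Λ(n)` (an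
infinite cluster leaves every box, `toBdry_of_percolatesAt`) and are not joined to each other
inside `Λ(n)` (because `Λ(n) + X e₀ ⊆ ℍ`). [folklore] -/
theorem toOrigin_mem_twoArms_of_not_openConnIn {ω : BondConfig (Site 3)}
    (hω : ω ⊆ (zdGraph 3).edgeSet) {X n R s s' : ℕ} (hRn : R ≤ n) (hnX : n ≤ X)
    (hXs : X ≤ s) (hsR : s ≤ X + R) (hXs' : X ≤ s') (hs'R : s' ≤ X + R)
    (hs : ω ∈ percolatesAt (Pi.single 0 (s : ℤ) : Site 3))
    (hs' : ω ∈ percolatesAt (Pi.single 0 (s' : ℤ) : Site 3))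
    (hnot : ω ∉ openConnIn {x : Site 3 | 0 ≤ x 0} (Pi.single 0 (s : ℤ) : Site 3)
      (Pi.single 0 (s' : ℤ))) :
    toOrigin (Pi.single 0 (X : ℤ) : Site 3) ω ∈
      {ω : BondConfig (Site 3) | ∃ u ∈ box 3 R, ∃ v ∈ box 3 R,
        (∃ y ∈ innerBoundary (zdGraph 3) (box 3 n), ω ∈ openConnIn ↑(box 3 n) u y) ∧
        (∃ y ∈ innerBoundary (zdGraph 3) (box 3 n), ω ∈ openConnIn ↑(box 3 n) v y) ∧
        ω ∉ openConnIn ↑(box 3 n) u v} := by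
  set ω' := toOrigin (Pi.single 0 (X : ℤ) : Site 3) ω with hω'
  have hω'E : (ω' : BondConfig (Site 3)) ⊆ (zdGraph 3).edgeSet := toOrigin_subset_edgeSet hω
  -- the two points seen from `X e₀`
  have hu : ω' ∈ percolatesAt (Pi.single 0 ((s : ℤ) - X) : Site 3) := by
    rw [hω', toOrigin_axis_mem_percolatesAt_iff, sub_add_cancel]; exact hs
  have hv : ω' ∈ percolatesAt (Pi.single 0 ((s' : ℤ) - X) : Site 3) := by
    rw [hω', toOrigin_axis_mem_percolatesAt_iff, sub_add_cancel]; exact hs'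
  have huR : (Pi.single 0 ((s : ℤ) - X) : Site 3) ∈ box 3 R :=
    axisPt_mem_box_iff.2 ⟨by omega, by omega⟩
  have hvR : (Pi.single 0 ((s' : ℤ) - X) : Site 3) ∈ box 3 R :=
    axisPt_mem_box_iff.2 ⟨by omega, by omega⟩
  refine ⟨_, huR, _, hvR, toBdry_of_percolatesAt (box_mono 3 hRn huR) hω'E hu,
    toBdry_of_percolatesAt (box_mono 3 hRn hvR) hω'E hv, fun hc => hnot ?_⟩
  -- a connection inside `Λ(n)` seen from `X e₀` is a connection inside `Λ(n) + X e₀ ⊆ ℍ`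
  have key := GM.relabel_mem_openConnIn_iff (Site.shift (-(Pi.single 0 (X : ℤ) : Site 3)))
    (↑(box 3 n) : Set (Site 3)) (Pi.single 0 (s : ℤ)) (Pi.single 0 (s' : ℤ)) ω
  rw [Site.shift_apply, Site.shift_apply, axisPt_add_neg, axisPt_add_neg] at key
  exact openConnIn_mono (shift_preimage_box_subset_halfSpace hnX) _ _ (key.1 hc)

/-- Block arithmetic: for `L ≤ t` and `r ≥ 1`, the block point `X = L + ⌊(t-L)/r⌋ r` satisfies
`X ≤ t < X + r`. [folklore] -/
theorem blockPoint_le_lt {L r t : ℕ} (hr : 1 ≤ r) (hLt : L ≤ t) :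
    L + (t - L) / r * r ≤ t ∧ t < L + (t - L) / r * r + r := by
  have h1 := Nat.div_add_mod (t - L) r
  have h2 := Nat.mod_lt (t - L) (by omega : 0 < r)
  constructor
  · have := Nat.div_mul_le_self (t - L) r
    omega
  · have h3 : (t - L) / r * r = r * ((t - L) / r) := Nat.mul_comm _ _
    omega

/-- **A point of the ray in an infinite cluster is renewed**, unless a bad event happens. Let
`ω ⊆ E(ℤ³)`, `1 ≤ r`, `2r ≤ n ≤ L ≤ t`, let `t e₀` lie in an infinite cluster, and suppose that
(i) seen from the block point `X e₀`, `X = L + ⌊(t-L)/r⌋ r`, the two-arms event `A₂(2r, n)` does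
NOT occur, and (ii) seen from `t e₀`, the vacancy event `{0 ↔ ∞, e₀ ↮ ∞, …, r e₀ ↮ ∞}` does NOT
occur. Then some later axis point `t' e₀`, `t < t'`, lies in an infinite cluster and is joined to
`t e₀` by an open path inside the half-space `ℍ`: by (ii) some `t' = t + i`, `1 ≤ i ≤ r`, is in
an infinite cluster, and if it were not joined to `t e₀` inside `ℍ`, (i) would fail by
`toOrigin_mem_twoArms_of_not_openConnIn` (`X ≤ t < t' ≤ X + 2r`). [folklore] -/
theorem exists_next_of_not_bad {ω : BondConfig (Site 3)} (hω : ω ⊆ (zdGraph 3).edgeSet)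
    {L r n t : ℕ} (hr : 1 ≤ r) (hrn : 2 * r ≤ n) (hnL : n ≤ L) (hLt : L ≤ t)
    (ht : ω ∈ percolatesAt (Pi.single 0 (t : ℤ) : Site 3))
    (hS : toOrigin (Pi.single 0 ((L + (t - L) / r * r : ℕ) : ℤ) : Site 3) ω ∉
      {ω : BondConfig (Site 3) | ∃ u ∈ box 3 (2 * r), ∃ v ∈ box 3 (2 * r),
        (∃ y ∈ innerBoundary (zdGraph 3) (box 3 n), ω ∈ openConnIn ↑(box 3 n) u y) ∧
        (∃ y ∈ innerBoundary (zdGraph 3) (box 3 n), ω ∈ openConnIn ↑(box 3 n) v y) ∧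
        ω ∉ openConnIn ↑(box 3 n) u v})
    (hV : toOrigin (Pi.single 0 (t : ℤ) : Site 3) ω ∉
      {ω : BondConfig (Site 3) | ω ∈ percolatesAt (0 : Site 3) ∧
        ∀ i : ℕ, 1 ≤ i → i ≤ r → ω ∉ percolatesAt (Pi.single 0 (i : ℤ) : Site 3)}) :
    ∃ t' : ℕ, t < t' ∧ ω ∈ percolatesAt (Pi.single 0 (t' : ℤ) : Site 3) ∧
      ω ∈ openConnIn {x : Site 3 | 0 ≤ x 0} (Pi.single 0 (t : ℤ) : Site 3)
        (Pi.single 0 (t' : ℤ)) := by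
  -- (ii): some `t + i`, `1 ≤ i ≤ r`, is in an infinite cluster
  have hV' := (not_congr (mem_preimage_toOrigin_vac_iff t r ω)).1 hV
  push Not at hV'
  obtain ⟨i, hi1, hir, hi⟩ := hV' ht
  have hcast : ((i : ℤ) + t) = ((t + i : ℕ) : ℤ) := by push_cast; ring
  rw [hcast] at hi
  refine ⟨t + i, by omega, hi, ?_⟩
  -- (i): otherwise two arms near the block point
  by_contra hnot
  obtain ⟨hXt, htX⟩ := blockPoint_le_lt hr hLt (L := L) (t := t)
  exact hS (toOrigin_mem_twoArms_of_not_openConnIn hω (R := 2 * r) hrn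
    (hnL.trans (Nat.le_add_right _ _)) hXt (by omega) (by omega) (by omega) ht hi hnot)

/-- **Unbounded renewal makes the half-space piece infinite.** If every axis point `t e₀`,
`t ≥ T`, lying in an infinite cluster is joined inside `ℍ` to a later axis point in an infinite
cluster, then for every `t₀ ≥ T` with `t₀ e₀ ↔ ∞` the set of sites joined to `t₀ e₀` inside `ℍ`
is infinite (it contains an unbounded set of axis points, by induction and transitivity of
`openConnIn`). [folklore] -/
theorem piece_infinite_of_forall_exists_next {ω : BondConfig (Site 3)} {T t₀ : ℕ} (hT : T ≤ t₀)
    (ht₀ : ω ∈ percolatesAt (Pi.single 0 (t₀ : ℤ) : Site 3))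
    (h : ∀ t : ℕ, T ≤ t → ω ∈ percolatesAt (Pi.single 0 (t : ℤ) : Site 3) →
      ∃ t' : ℕ, t < t' ∧ ω ∈ percolatesAt (Pi.single 0 (t' : ℤ) : Site 3) ∧
        ω ∈ openConnIn {x : Site 3 | 0 ≤ x 0} (Pi.single 0 (t : ℤ) : Site 3)
          (Pi.single 0 (t' : ℤ))) :
    {y : Site 3 | ω ∈ openConnIn {x : Site 3 | 0 ≤ x 0}
      (Pi.single 0 (t₀ : ℤ) : Site 3) y}.Infinite := by
  set U : Set ℕ := {s | t₀ ≤ s ∧ ω ∈ percolatesAt (Pi.single 0 (s : ℤ) : Site 3) ∧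
    ω ∈ openConnIn {x : Site 3 | 0 ≤ x 0} (Pi.single 0 (t₀ : ℤ) : Site 3) (Pi.single 0 (s : ℤ))}
    with hU
  have h0 : t₀ ∈ U := by
    refine ⟨le_rfl, ht₀, openConnIn_refl ?_⟩
    simp
  have hstep : ∀ s ∈ U, ∃ s' ∈ U, s < s' := by
    rintro s ⟨hs0, hs, hconn⟩
    obtain ⟨s', hss', hs', hconn'⟩ := h s (hT.trans hs0) hs
    exact ⟨s', ⟨by omega, hs', GM.openConnIn_trans hconn hconn'⟩, hss'⟩
  have hunb : ∀ N : ℕ, ∃ s ∈ U, N ≤ s := by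
    intro N
    induction N with
    | zero => exact ⟨t₀, h0, Nat.zero_le _⟩
    | succ N ih =>
      obtain ⟨s, hs, hNs⟩ := ih
      obtain ⟨s', hs', hss'⟩ := hstep s hs
      exact ⟨s', hs', by omega⟩
  have hUinf : U.Infinite := by
    refine Set.infinite_of_not_bddAbove ?_
    rintro ⟨B, hB⟩
    obtain ⟨s, hs, hBs⟩ := hunb (B + 1)
    have := hB hs
    omega
  refine ((hUinf.image axisPt_natCast_injective.injOn).mono ?_)
  rintro y ⟨s, hs, rfl⟩
  exact hs.2.2

/-! ## The scales

At scale `k` (with an integer parameter `a ≥ 1`): short radius `ρ_k = 2^{ak}`, gap threshold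
`r_k = 2ρ_k = 2^{ak+1}`, two-arms radii `2r_k = 2^{ak+2} ≤ n_k = 2^{(a+1)k+2}`, depth window
`[L_k, L_{k+1})` with `L_k = 2^{(a+1)k+3} ≥ n_k`, block points `L_k + j r_k`,
`j < J_k = (L_{k+1} - L_k)/r_k + 1`. -/

/-- Every depth `t ≥ L_K` lies in a window `[L_k, L_{k+1})` with `k ≥ K`. [folklore] -/
theorem exists_scale (a K t : ℕ) (ht : 2 ^ ((a + 1) * K + 3) ≤ t) :
    ∃ k, K ≤ k ∧ 2 ^ ((a + 1) * k + 3) ≤ t ∧ t < 2 ^ ((a + 1) * (k + 1) + 3) := by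
  have hex : ∃ k, t < 2 ^ ((a + 1) * (k + 1) + 3) := by
    refine ⟨t, lt_of_lt_of_le (Nat.lt_two_pow_self) (Nat.pow_le_pow_right (by norm_num) ?_)⟩
    nlinarith
  classical
  refine ⟨Nat.find hex, ?_, ?_, Nat.find_spec hex⟩
  · have h1 : 2 ^ ((a + 1) * K + 3) < 2 ^ ((a + 1) * (Nat.find hex + 1) + 3) :=
      lt_of_le_of_lt ht (Nat.find_spec hex)
    have h2 := (Nat.pow_lt_pow_iff_right (by norm_num : 1 < 2)).1 h1
    nlinarith
  · rcases h0 : Nat.find hex with _ | j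
    · calc 2 ^ ((a + 1) * 0 + 3) ≤ 2 ^ ((a + 1) * K + 3) :=
            Nat.pow_le_pow_right (by norm_num) (by nlinarith)
        _ ≤ t := ht
    · have := Nat.find_min hex (m := j) (by omega)
      push Not at this
      exact this

/-- The number of blocks at scale `k` is at most `2^{k+a+4}`. [folklore] -/
theorem numBlocks_le (a k : ℕ) :
    (2 ^ ((a + 1) * (k + 1) + 3) - 2 ^ ((a + 1) * k + 3)) / 2 ^ (a * k + 1) + 1 ≤
      2 ^ (k + a + 4) := by
  have h1 : (2 ^ ((a + 1) * (k + 1) + 3) - 2 ^ ((a + 1) * k + 3)) / 2 ^ (a * k + 1) ≤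
      2 ^ ((a + 1) * (k + 1) + 3) / 2 ^ (a * k + 1) := Nat.div_le_div_right (Nat.sub_le _ _)
  have h2 : 2 ^ ((a + 1) * (k + 1) + 3) / 2 ^ (a * k + 1) = 2 ^ (k + a + 3) := by
    rw [Nat.pow_div (by nlinarith) (by norm_num)]
    congr 1
    rw [Nat.sub_eq_iff_eq_add (by nlinarith)]
    ring
  have h3 : 1 ≤ 2 ^ (k + a + 3) := Nat.one_le_two_pow
  have h4 : 2 ^ (k + a + 4) = 2 * 2 ^ (k + a + 3) := by ring
  calc _ ≤ 2 ^ (k + a + 3) + 1 := by omega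
    _ ≤ 2 ^ (k + a + 4) := by omega

/-- The ratio of the two-arms radii at scale `k` is `2^{-k}`. [folklore] -/
theorem radii_ratio (a k : ℕ) :
    ((2 * 2 ^ (a * k + 1) : ℕ) : ℝ) / ((2 ^ ((a + 1) * k + 2) : ℕ) : ℝ) = (1 / 2 : ℝ) ^ k := by
  have hx : ((2 * 2 ^ (a * k + 1) : ℕ) : ℝ) ≠ 0 := by positivity
  have h : ((2 ^ ((a + 1) * k + 2) : ℕ) : ℝ) = ((2 * 2 ^ (a * k + 1) : ℕ) : ℝ) * 2 ^ k := by
    push_cast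
    ring
  rw [h, div_mul_eq_div_div, div_self hx, one_div_pow]

/-- **The two-arms blocks are rare.** If an event `A` has `P(A) ≤ C (2r_k/n_k)^c` with `c > 1`
(the two-arms bound of `TwoArmsRatioExponent` at the radii of scale `k`), then the union of its
translates to the `J_k ≤ 2^{k+a+4}` block points has probability
`≤ C 2^{a+4} (2^{1-c})^k`. [folklore] -/
theorem real_blocks_le {A : Set (BondConfig (Site 3))} {C c : ℝ} (a k : ℕ)
    (hA : (bondPercolation (zdGraph 3) (criticalProbI 3)).real A ≤
      C * (((2 * 2 ^ (a * k + 1) : ℕ) : ℝ) / ((2 ^ ((a + 1) * k + 2) : ℕ) : ℝ)) ^ c)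
    (x : ℕ → Site 3) :
    (bondPercolation (zdGraph 3) (criticalProbI 3)).real
        (⋃ j ∈ Finset.range ((2 ^ ((a + 1) * (k + 1) + 3) - 2 ^ ((a + 1) * k + 3)) /
          2 ^ (a * k + 1) + 1), toOrigin (x j) ⁻¹' A) ≤
      C * 2 ^ (a + 4) * (2 * (1 / 2 : ℝ) ^ c) ^ k := by
  refine (real_biUnion_preimage_toOrigin_le _ _ A).trans ?_
  rw [Finset.card_range, radii_ratio] at *
  have hJ : (((2 ^ ((a + 1) * (k + 1) + 3) - 2 ^ ((a + 1) * k + 3)) / 2 ^ (a * k + 1) + 1 : ℕ) : ℝ)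
      ≤ (2 : ℝ) ^ (k + a + 4) := by exact_mod_cast numBlocks_le a k
  calc _ ≤ (2 : ℝ) ^ (k + a + 4) * (C * ((1 / 2 : ℝ) ^ k) ^ c) :=
        mul_le_mul hJ hA measureReal_nonneg (by positivity)
    _ = C * 2 ^ (a + 4) * (2 * (1 / 2 : ℝ) ^ c) ^ k := by
        rw [← Real.rpow_pow_comm (by norm_num) c k, mul_pow, pow_add, pow_add]
        ring

/-- **The vacant-gap blocks are rare.** If the line-avoidance events satisfy
`P(e₀ ↮ ∞, …, m e₀ ↮ ∞) ≤ C m^{-κ}` for `m ≥ 1` (the conclusion of `JumpLineAvoidanceDecay`),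
then the union over the depths `t ∈ [L_k, L_{k+1})` of the translates to `t e₀` of the vacancy
event `{0 ↔ ∞, e₀ ↮ ∞, …, r_k e₀ ↮ ∞}` has probability `≤ C 2^{a+4} (2 (2^a)^{-κ})^k`
(union bound, `vac_antitone`, `renewal_ineq` with `m = ρ_k = 2^{ak}`). [folklore] -/
theorem real_lineBlocks_le {C κ : ℝ}
    (hG : ∀ m : ℕ, 1 ≤ m → (bondPercolation (zdGraph 3) (criticalProbI 3)).real
      {ω | ∀ i : ℕ, 1 ≤ i → i ≤ m → ω ∉ percolatesAt (Pi.single 0 (i : ℤ) : Site 3)} ≤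
        C * (m : ℝ) ^ (-κ)) (a k : ℕ) :
    (bondPercolation (zdGraph 3) (criticalProbI 3)).real
        (⋃ t ∈ Finset.Ico (2 ^ ((a + 1) * k + 3)) (2 ^ ((a + 1) * (k + 1) + 3)),
          toOrigin (Pi.single 0 ((t : ℕ) : ℤ) : Site 3) ⁻¹'
            {ω | ω ∈ percolatesAt (0 : Site 3) ∧ ∀ i : ℕ, 1 ≤ i → i ≤ 2 ^ (a * k + 1) →
              ω ∉ percolatesAt (Pi.single 0 (i : ℤ) : Site 3)}) ≤
      C * 2 ^ (a + 4) * (2 * ((2 : ℝ) ^ a) ^ (-κ)) ^ k := by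
  set ρ : ℕ := 2 ^ (a * k) with hρ
  have hρ1 : 1 ≤ ρ := Nat.one_le_two_pow
  have hρpos : (0 : ℝ) < ρ := by exact_mod_cast hρ1
  -- the vacancy event of length `r_k = 2ρ` is contained in that of length `2ρ - 1`
  have hanti := vac_antitone (M := 2 ^ (a * k + 1)) (M' := 2 * ρ - 1) (by rw [hρ, pow_succ]; omega)
  -- `ρ · P(vac(2ρ-1)) ≤ P(E ρ) ≤ C ρ^{-κ}`
  have hren := renewal_ineq ρ
  have hGρ := hG ρ hρ1
  have hvac : (bondPercolation (zdGraph 3) (criticalProbI 3)).real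
      {ω | ω ∈ percolatesAt (0 : Site 3) ∧ ∀ i : ℕ, 1 ≤ i → i ≤ 2 * ρ - 1 →
        ω ∉ percolatesAt (Pi.single 0 (i : ℤ) : Site 3)} ≤ C * (ρ : ℝ) ^ (-κ) / ρ := by
    rw [le_div_iff₀ hρpos, mul_comm]
    exact hren.trans hGρ
  refine (real_biUnion_preimage_toOrigin_le _ _ _).trans ?_
  rw [Nat.card_Ico]
  have hcard : ((2 ^ ((a + 1) * (k + 1) + 3) - 2 ^ ((a + 1) * k + 3) : ℕ) : ℝ) ≤
      (2 : ℝ) ^ ((a + 1) * (k + 1) + 3) := by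
    exact_mod_cast Nat.sub_le _ _
  have hP := (measureReal_mono hanti (measure_ne_top _ _)
    (μ := bondPercolation (zdGraph 3) (criticalProbI 3))).trans hvac
  calc _ ≤ (2 : ℝ) ^ ((a + 1) * (k + 1) + 3) * (C * (ρ : ℝ) ^ (-κ) / ρ) :=
        mul_le_mul hcard hP measureReal_nonneg (by positivity)
    _ = C * 2 ^ (a + 4) * (2 * ((2 : ℝ) ^ a) ^ (-κ)) ^ k := by
        have h2 : (ρ : ℝ) = ((2 : ℝ) ^ a) ^ k := by rw [hρ]; push_cast; rw [pow_mul]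
        have h3 : (2 : ℝ) ^ ((a + 1) * (k + 1) + 3) = 2 ^ (a + 4) * 2 ^ k * ((2 : ℝ) ^ a) ^ k := by
          rw [← pow_mul, ← pow_add, ← pow_add]; congr 1; ring
        rw [h2, ← Real.rpow_pow_comm (by positivity) (-κ) k, h3, mul_pow]
        field_simp

/-- **Renewal at scale `k`.** For `ω ⊆ E(ℤ³)` outside both bad unions of scale `k`, every
`t ∈ [L_k, L_{k+1})` with `t e₀ ↔ ∞` is joined inside `ℍ` to a later axis point of an infinite
cluster (`exists_next_of_not_bad` at the block point `L_k + ⌊(t - L_k)/r_k⌋ r_k`). [folklore] -/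
theorem exists_next_at_scale {ω : BondConfig (Site 3)} (hω : ω ⊆ (zdGraph 3).edgeSet)
    {a k t : ℕ} (hLt : 2 ^ ((a + 1) * k + 3) ≤ t) (htL : t < 2 ^ ((a + 1) * (k + 1) + 3))
    (ht : ω ∈ percolatesAt (Pi.single 0 (t : ℤ) : Site 3))
    (hS : ω ∉ ⋃ j ∈ Finset.range ((2 ^ ((a + 1) * (k + 1) + 3) - 2 ^ ((a + 1) * k + 3)) /
          2 ^ (a * k + 1) + 1),
        toOrigin (Pi.single 0 ((2 ^ ((a + 1) * k + 3) + j * 2 ^ (a * k + 1) : ℕ) : ℤ) : Site 3) ⁻¹'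
          {ω : BondConfig (Site 3) | ∃ u ∈ box 3 (2 * 2 ^ (a * k + 1)),
            ∃ v ∈ box 3 (2 * 2 ^ (a * k + 1)),
            (∃ y ∈ innerBoundary (zdGraph 3) (box 3 (2 ^ ((a + 1) * k + 2))),
              ω ∈ openConnIn ↑(box 3 (2 ^ ((a + 1) * k + 2))) u y) ∧
            (∃ y ∈ innerBoundary (zdGraph 3) (box 3 (2 ^ ((a + 1) * k + 2))),
              ω ∈ openConnIn ↑(box 3 (2 ^ ((a + 1) * k + 2))) v y) ∧
            ω ∉ openConnIn ↑(box 3 (2 ^ ((a + 1) * k + 2))) u v})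
    (hV : ω ∉ ⋃ s ∈ Finset.Ico (2 ^ ((a + 1) * k + 3)) (2 ^ ((a + 1) * (k + 1) + 3)),
        toOrigin (Pi.single 0 ((s : ℕ) : ℤ) : Site 3) ⁻¹'
          {ω | ω ∈ percolatesAt (0 : Site 3) ∧ ∀ i : ℕ, 1 ≤ i → i ≤ 2 ^ (a * k + 1) →
            ω ∉ percolatesAt (Pi.single 0 (i : ℤ) : Site 3)}) :
    ∃ t' : ℕ, t < t' ∧ ω ∈ percolatesAt (Pi.single 0 (t' : ℤ) : Site 3) ∧
      ω ∈ openConnIn {x : Site 3 | 0 ≤ x 0} (Pi.single 0 (t : ℤ) : Site 3)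
        (Pi.single 0 (t' : ℤ)) := by
  set L := 2 ^ ((a + 1) * k + 3) with hL
  set L' := 2 ^ ((a + 1) * (k + 1) + 3) with hL'
  set r := 2 ^ (a * k + 1) with hr
  set n := 2 ^ ((a + 1) * k + 2) with hn
  have hr1 : 1 ≤ r := Nat.one_le_two_pow
  have hrn : 2 * r ≤ n := by
    rw [hr, hn, ← pow_succ']
    exact Nat.pow_le_pow_right (by norm_num) (by nlinarith)
  have hnL : n ≤ L := Nat.pow_le_pow_right (by norm_num) (by omega)
  refine exists_next_of_not_bad hω hr1 hrn hnL hLt ht (fun hmem => hS ?_) (fun hmem => hV ?_)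
  · simp only [Set.mem_iUnion, Finset.mem_range, exists_prop]
    refine ⟨(t - L) / r, ?_, ?_⟩
    · exact Nat.lt_succ_of_le (Nat.div_le_div_right (by omega))
    · exact hmem
  · simp only [Set.mem_iUnion, Finset.mem_Ico, exists_prop]
    exact ⟨t, ⟨hLt, htL⟩, hmem⟩

end RayRenewal

end Summit.CriticalPhenomena.PercolationContinuityZ3.Theorems

end
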